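import Literature.NumberTheory.LFunctions.SubnormalZetaGapsLOneLowerBound
import Literature.NumberTheory.LFunctions.UniformClassGroupPNT
import HarnessLib

/-!
# Conrey–Iwaniec (2002), §1 and §10: many subnormal gaps between critical zeros of a class group
# `L`-function of `ℚ(√−q)` force an effective lower bound for `L(1, χ)` (Theorem 1.1,
# Corollary 1.3, Proposition 10.1, Corollary 10.2)

LABEL: **NOT RH-BEARING.** Every statement in this file is an UNCONDITIONAL implication printed by
Conrey–Iwaniec ("no Riemann hypothesis is required", §1): a hypothesis about the spacing of zeros ON
the critical line (or about small values of `L′`) implies a lower bound for `L(1, χ)`. No statement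
assumes or concludes anything about `RiemannHypothesis`; nothing here bears on the truth of RH, on
the existence of exceptional characters, or on the actual spacing of zeros (cell `rh-crit`, corpus
C5 `ah`, bears_on LADDER-RH §4 HELD «conditional bridges: exceptional zero ⇒ …»).

Topic `Literature/NumberTheory/LFunctions` (namespace `Literature.NumberTheory.LFunctions`; the
paper's internal objects — `D(α,T)`, the divided difference `(L(s) − L(s′))/(s − s′)`, admissible
point sets `S(T)` — live in the sub-namespace `ConreyIwaniec2002`). STATEMENT LAYER: four NAMED
FACTS (D-0014; `def … : Prop`, not proved here) — Theorem 1.1, Corollary 1.3, Proposition 10.1,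
Corollary 10.2 — plus PROVED bookkeeping: Corollary 10.2 from the tree's Theorem 1.2
(`conreyIwaniec2002_theorem12`, file `SubnormalZetaGapsLOneLowerBound.lean`, which is CITED, not
retyped), the printed numerical specialisation of Theorem 1.1 (`A = 12`), and the dictionary lemma
identifying the tree's `HasCloseCriticalNeighbour` with this file's generic close-zero predicate.

## What the source prints (held text `paper:arxiv-math_0111012`, corpus-tex, 22 chunks, read 2026-08-26)

B. Conrey, H. Iwaniec, *Spacing of zeros of Hecke `L`-functions and the class number problem*,
Acta Arith. 103 (2002) 259–312 [ConreyIwaniec2002].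

**§1, standing data** (chunk p0001:L52–60, p0002:L80–103). `K = ℚ(√−q)`, "we assume that `−q` is a
fundamental discriminant, `q > 4`"; `χ(n) = (−q/n)` "the real character `χ` of conductor `q` (the
Kronecker symbol)" (1.2); `L(s,ψ) = Σ_𝔞 ψ(𝔞)(N𝔞)^{−s}` for `ψ ∈ Ĉℓ(K)` (1.16). "Let `ρ = ½ + iγ`
denote the zeros of `L(s,ψ)` on the critical line and `ρ′ = ½ + iγ′` denote the nearest zero to
`ρ` on the critical line (we assume that `ρ′ ≠ ρ` except when `ρ` is a multiple zero in which
case `ρ′ = ρ`). Note that we do not count zeros off the critical line, but we allow them to exist.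
For `0 < α ≤ 1` and `T ≥ 2` we put
`D(α,T) = #{ρ ; 2 ≤ γ ≤ T, |γ − γ′| ≤ π(1−α)/log γ}` (1.19)."

> **Theorem 1.1** (p0002:L104–112). Let `A ≥ 0` and `log T ≥ (log q)^{A+6}`. Suppose
> `D(α,T) ≥ c T log T / (α (log q)^A)` (1.20) for some `0 < α ≤ 1`, where `c` is a large
> absolute constant. Then `L(1,χ) ≥ (log T)^{−2} (log q)^{−2A−6}` (1.21).

"This result is a special case of Proposition 10.1. Taking `A = 12` and `log T = (log q)^{18}` we
get `L(1,χ) ≥ (log q)^{−66}`, provided `D(α,T) ≥ α^{−1} c T (log T)^{1/3}`." (p0002:L114–116.)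

**Theorem 1.2** (p0003:L8–19) is the tree's `conreyIwaniec2002_theorem12` — cited, not retyped.

> **Corollary 1.3** (p0003:L28–35). Suppose there are points `2 ≤ t₁ < … < t_R ≤ T` with
> `t_{r+1} − t_r ≥ 1` such that `|L′(½ + it_r, ψ)| ≤ (log q)^{7/2}` for `r = 1,…,R`, where
> `R ≫ T = exp((log q)^6)`. Then `L(1,χ) ≫ (log q)^{−18}`.

("As an illustration, the following assertion follows immediately from Proposition 10.1.")

**§7, standing data for §§7–10** (chunk p0017:L17–35): "We restrict our attention to `L`-functions
for class group characters of an imaginary quadratic field `K = ℚ(√−q)` where `−q` is the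
discriminant. We assume that `q` is odd and `q > 4`, so `q ≡ 3 (mod 4)` and `q` is squarefree. Fix
`ψ ∈ Ĉℓ(K)` … `L(s) = Σ λ(n) n^{−s}` (7.3) … if `ψ` is the trivial character …
`L(s) = ζ_K(s) = ζ(s)L(s,χ)` (7.7)." §10 (p0021:L1–16): "`ℓ(s) = (L(s) − L(s′))/(s − s′) = 0` (10.1)
… the condition (10.1) means that `s` and its companion `s′` are on the same level curve of `L(s)`
(and `L′(s) = 0` if `s = s′`)."

> **Proposition 10.1** (p0021:L53–74). Let `A ≥ 0` and `log T ≥ (log q)^{A+6}`. Suppose there is a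
> set of points `S(T) = {s_r = ½ + it_r ; 2 ≤ t₁ < … < t_R ≤ T, t_{r+1} − t_r ≥ 1}` and a set of
> companions `S′(T) = {s′_r = ½ + it′_r ; r = 1,…,R}` such that
> `|t_r − t′_r| ≤ π(1−α)/log t_r`, with `0 < α ≤ 1` (10.10),
> `|(L(s_r) − L(s′_r))/(s_r − s′_r)| ≤ (log q)^{7/2}` (10.11).
> Suppose the number of points in the set satisfies `R = |S(T)| ≥ cT/(α (log q)^A)` (10.12) where
> `c` is a large absolute constant, effectively computable. Then
> `L(1,χ) ≥ (log T)^{−2} (log q)^{−2A−6}` (10.13).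

> **Corollary 10.2** (p0021:L105–119; "Taking `A = 12` and `α = (log T)^{−1/2}` we derive from
> Proposition 10.1 the following"). Let `ρ = ½ + iγ` denote the zeros of `ζ(s)` on the critical
> line and `ρ′ = ½ + iγ′` denote the nearest zero to `ρ` on the critical line (`ρ′ = ρ` if it is a
> multiple zero). Suppose that `#{ρ ; 0 < j ≤ T, |γ − γ′| ≤ (π/log γ)(1 − 1/√log γ)} ≫ T (log T)^{4/5}`
> (10.14) for any `T ≥ 2001`. Then we have `L(1,χ) ≫ (log q)^{−90}` (10.15) where the implied
> constant is effectively computable in terms of that in (10.14).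

(`j` in (10.14) is a misprint for `γ`: the display is otherwise character-for-character (1.22).)
Printed proof (p0021:L121–129): "The number of zeros `ρ = ½ + iγ` with `t < γ ≤ t + 1` is bounded
by `O(log t)`. Therefore one can select from the set of zeros in (10.14) a subset of well-spaced
points of cardinality `R ≫ T (log T)^{−1/5}`. This subset satisfies the conditions of Proposition
10.1 with `A = 14`, `log T = (log q)^{20}` and `α = (log T)^{−1/2} = (log q)^{−10}`, provided `q` is
sufficiently large, giving `L(1,χ) ≥ (log q)^{−90}`. For small `q` the lower bound (10.15) is
obtained by adjusting the implied constant."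

## Lean rendering / design choices (audit notes for rh-crit-ah-ref)

* `K = ℚ(√−q)`, `−q` fundamental, `q > 4`, `χ = (−q/·)`: as in the tree's Theorem 1.2 —
  `χ : DirichletCharacter ℂ q` primitive, quadratic and ODD with `4 < q` (this is equivalent to
  `−q` being a fundamental discriminant, tree `isFundamentalDiscriminant_neg`), and `K : Type` any
  number field with `finrank ℚ K = 2` and `NumberField.discr K = −q` (it exists:
  `exists_quadraticField_of_odd_primitive`; `ζ_K = ζ · L(·,χ)`:
  `dedekindZeta_eq_riemannZeta_mul_LFunction_of_odd_primitive`). `ψ ∈ Ĉℓ(K)` is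
  `ψ : ClassGroup (𝓞 K) →* ℂˣ` and `L(s,ψ)` is the tree's `NumberField.classGroupLFunction K ψ`
  (`= ζ_K` for `ψ = 1` off `s = 1`, `classGroupLFunction_one`). `L(1,χ)` (real, positive) is
  `‖χ.LFunction 1‖` as in Theorem 1.2.
* §1 statements (Theorem 1.1, Corollary 1.3) carry §1's standing hypotheses (no parity condition
  on `q`); §10 statements (Proposition 10.1, Corollary 10.2) carry §7's "`q` odd" as `Odd q`
  EXPLICITLY. Consequence, reported to the referee rather than repaired: Corollary 10.2 AS PRINTED IN
  §10 is the `q`-odd case of the tree's Theorem 1.2 (typed from §1 without parity restriction) —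
  `conreyIwaniec2002_corollary102_of_theorem12` is proved below; the converse is not claimed.
* "nearest zero `ρ′` on the line, `ρ′ = ρ` if multiple, `|γ − γ′| ≤ r`" ⟺ `ρ` is a multiple zero
  (`deriv L ρ = 0`) or SOME critical zero `γ′ ≠ γ` lies within `r` — `ConreyIwaniec2002.HasCloseZero`
  (generic in `L : ℂ → ℂ`; for `L = ζ`, `r = ciRadius γ` it is DEFINITIONALLY the tree's
  `HasCloseCriticalNeighbour`, lemma `hasCloseZero_riemannZeta_ciRadius_iff`). `D(α,T)` counts the
  points `ρ`, i.e. distinct ordinates: `Set.ncard` (`closeZeroCount`; an infinite set has `ncard 0`,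
  which only makes a hypothesis "`D ≥ …`" harder to meet).
* `(L(s) − L(s′))/(s − s′)` with the printed convention "`L′(s)` if `s = s′`":
  `ConreyIwaniec2002.dividedDifference`.
* Point sets: a `Finset ℝ` of ordinates in `[2, T]`, pairwise `1`-separated
  (`ConreyIwaniec2002.IsPointSet`; for a finite set of reals this is "`t_{r+1} − t_r ≥ 1`"),
  companions as a function `t′ : ℝ → ℝ` (only its values on the set matter).
* Guards `2 ≤ T`, `0 < α`: printed ("`T ≥ 2`", "`0 < α ≤ 1`"); they also keep `Real.log T` honest
  (Lean's `log` of a negative number is `log |T|`).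
* Constants. "`c` is a large absolute constant" ((1.20), (10.12)) ⟹ `∃ c > 0` OUTERMOST (absolute:
  before `A`, `q`, `K`, `ψ`, `T`, `α`). "`≫`" in the HYPOTHESIS (10.14) with "implied constant [of
  (10.15)] effectively computable in terms of that in (10.14)" ⟹ `∀ c > 0, ∃ c′ > 0` (as the tree's
  Theorem 1.2). Corollary 1.3's "`R ≫ T` … then `L(1,χ) ≫ (log q)^{−18}`" is rendered under the
  SAME `≫`-in-hypothesis convention, `∀ c₁ > 0, ∃ c′ > 0` (cell RULE V1, rh-crit-ah-lead
  2026-08-26T02:29Z: since a `1`-separated set in `[2, T₀]` has `R ≤ T₀ − 1`, "`R ≫ T₀`" can only be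
  a PROPORTION; an `∃ c₁` reading is vacuous — the first landing of this file had it and was
  repaired). Conrey–Iwaniec's one-line derivation of Corollary 1.3 from Proposition 10.1 (`A = 0`,
  `α = 1`, `s′_r = s_r`) covers only `c₁ ≥ c`, the absolute constant of (10.12); the printed
  corollary is therefore flagged as a claim with a recorded derivation gap, and the derivation
  itself is vendored exactly, with the constant COUPLED, as the proved
  `ConreyIwaniec2002.corollary13With_of_proposition101With`
  (`proposition101With c` = Proposition 10.1 at the constant `c`; `corollary13With c` = Corollary
  1.3 with threshold `c·T₀` and conclusion `(log q)^{−18} ≤ L(1,χ)`, under §7's `q` odd).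
  Effective computability is not expressible and is recorded here only. Real exponents are
  `Real.rpow` (`(log q)^{A+6}`, `(log q)^{−2A−6}`, …).

WHAT THIS IS NOT: no claim about RH, about Siegel zeros, or that any `L(s,ψ)` has subnormal gaps;
typing a printed implication is transcription. Discharges (prover phase, this corpus): Corollary 1.3
from Proposition 10.1 with COUPLED constant (`s′_r = s_r`, `α = 1`, `A = 0`) is proved in this file
(`ConreyIwaniec2002.corollary13With_of_proposition101With`); Corollary 10.2 and the odd-`q` case of
Theorem 1.1 from Proposition 10.1 are proved in `ConreyIwaniec2002Proofs.lean`; Proposition 10.1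
from the principal estimate (9.12) in `ConreyIwaniec2002MeanValues.lean`, whose Proposition 9.2 is
the FACT-LIST boundary (it rests on §§2–8).

## References

* [ConreyIwaniec2002] B. Conrey, H. Iwaniec, Acta Arith. 103 (2002) 259–312, arXiv:math/0111012:
  (1.2), (1.16), (1.19), Theorem 1.1 (1.20)–(1.21), Corollary 1.3, §7 (7.3)/(7.7), (10.1),
  Proposition 10.1 (10.10)–(10.13), Corollary 10.2 (10.14)–(10.15).
* Tree: `SubnormalZetaGapsLOneLowerBound.lean` (Theorem 1.2), `UniformClassGroupPNT.lean`
  (`classGroupLFunction`), `QuadraticDedekindZetaOddPrimitive.lean` (the field of `χ`).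
-/

noncomputable section

open scoped NumberField
open Complex

namespace Literature.NumberTheory.LFunctions

namespace ConreyIwaniec2002

/-! ### Vocabulary of §1 / §10 -/

/-- **`ρ = ½ + iγ` is a zero of `L` on the critical line whose nearest critical-line zero `ρ′` has
`|γ − γ′| ≤ r`, "`ρ′ = ρ` if `ρ` is a multiple zero"**: `L(½ + iγ) = 0` and either `ρ` is a multiple
zero (`L′(ρ) = 0`) or some critical zero `½ + iγ′`, `γ′ ≠ γ`, has `|γ − γ′| ≤ r`. Generic in the
function `L : ℂ → ℂ` (used with `L = L(·,ψ)` in (1.19) and with `L = ζ` in (10.14) = (1.22)).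
[cite: ConreyIwaniec2002, §1 (1.19)] -/
def HasCloseZero (L : ℂ → ℂ) (r γ : ℝ) : Prop :=
  L (1 / 2 + γ * I) = 0 ∧
    (deriv L (1 / 2 + γ * I) = 0 ∨ ∃ γ' : ℝ, γ' ≠ γ ∧ L (1 / 2 + γ' * I) = 0 ∧ |γ - γ'| ≤ r)

/-- The radius `π(1 − α)/log γ` of (1.19), (10.7) and (10.10) ("`1 − α` of the normal average
spacing `π/log γ`" of the zeros of `L(s,ψ)`, (1.18)). [cite: ConreyIwaniec2002, §1 (1.19)] -/
def gapRadius (α γ : ℝ) : ℝ :=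
  Real.pi * (1 - α) / Real.log γ

/-- The set counted by `D(α,T)` (1.19): ordinates `2 ≤ γ ≤ T` of critical zeros of `L` with a
critical neighbour within `π(1−α)/log γ` (or multiple). [cite: ConreyIwaniec2002, §1 (1.19)] -/
def closeZeroOrdinates (L : ℂ → ℂ) (α T : ℝ) : Set ℝ :=
  {γ : ℝ | 2 ≤ γ ∧ γ ≤ T ∧ HasCloseZero L (gapRadius α γ) γ}

/-- **`D(α,T) = #{ρ ; 2 ≤ γ ≤ T, |γ − γ′| ≤ π(1−α)/log γ}`** for the critical zeros `ρ = ½ + iγ` of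
`L` (points `ρ` counted once each = distinct ordinates; `Set.ncard`).
[cite: ConreyIwaniec2002, §1 (1.19)] -/
def closeZeroCount (L : ℂ → ℂ) (α T : ℝ) : ℕ :=
  (closeZeroOrdinates L α T).ncard

/-- **The divided difference `ℓ(s) = (L(s) − L(s′))/(s − s′)`** of (10.1)/(10.11), with the printed
convention that it means `L′(s)` when the companion `s′` coincides with `s` ("and `L′(s) = 0` if
`s = s′`"). [cite: ConreyIwaniec2002, §10 (10.1)] -/
def dividedDifference (L : ℂ → ℂ) (s s' : ℂ) : ℂ :=
  if s' = s then deriv L s else (L s - L s') / (s - s')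

/-- **An admissible point set `S(T)`** of Proposition 10.1: ordinates `2 ≤ t₁ < … < t_R ≤ T` with
`t_{r+1} − t_r ≥ 1` — a finite set of reals in `[2, T]`, pairwise at distance `≥ 1` (the points are
`s_r = ½ + it_r`). [cite: ConreyIwaniec2002, Proposition 10.1] -/
def IsPointSet (S : Finset ℝ) (T : ℝ) : Prop :=
  (∀ t ∈ S, 2 ≤ t ∧ t ≤ T) ∧ ∀ t ∈ S, ∀ u ∈ S, t ≠ u → 1 ≤ |t - u|

/-! ### API (proved) -/

/-- For `L = ζ` and the radius `(π/log γ)(1 − 1/√log γ)` of (1.22) = (10.14), `HasCloseZero` is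
definitionally the tree's `HasCloseCriticalNeighbour`. [cite: ConreyIwaniec2002, Theorem 1.2 (1.22)] -/
theorem hasCloseZero_riemannZeta_ciRadius_iff (γ : ℝ) :
    HasCloseZero riemannZeta (ciRadius γ) γ ↔ HasCloseCriticalNeighbour γ :=
  Iff.rfl

/-- A point with a close zero is itself a critical zero. [cite: ConreyIwaniec2002, §1 (1.19)] -/
theorem HasCloseZero.zero {L : ℂ → ℂ} {r γ : ℝ} (h : HasCloseZero L r γ) :
    L (1 / 2 + γ * I) = 0 :=
  h.1

/-- Enlarging the radius keeps a close zero close. [cite: ConreyIwaniec2002, §1 (1.19)] -/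
theorem HasCloseZero.mono {L : ℂ → ℂ} {r r' γ : ℝ} (hrr' : r ≤ r') (h : HasCloseZero L r γ) :
    HasCloseZero L r' γ := by
  refine ⟨h.1, h.2.imp id ?_⟩
  rintro ⟨γ', hne, hz, hle⟩
  exact ⟨γ', hne, hz, hle.trans hrr'⟩

/-- The radius `π(1−α)/log γ` is antitone in `α` for `γ > 1`. [cite: ConreyIwaniec2002, §1 (1.19)] -/
theorem gapRadius_anti {α α' γ : ℝ} (hγ : 1 < γ) (hαα' : α ≤ α') :
    gapRadius α' γ ≤ gapRadius α γ := by
  unfold gapRadius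
  have hlog : 0 < Real.log γ := Real.log_pos hγ
  exact div_le_div_of_nonneg_right (by nlinarith [Real.pi_pos]) hlog.le

/-- At `α = 1` the radius vanishes: only multiple zeros (or coincident companions) qualify.
[cite: ConreyIwaniec2002, §1 (1.19)] -/
@[simp] theorem gapRadius_one (γ : ℝ) : gapRadius 1 γ = 0 := by
  simp [gapRadius]

/-- The counted set shrinks as `α` grows (`0 < α`: fewer gaps are subnormal by the factor `1 − α`).
[cite: ConreyIwaniec2002, §1 (1.19)] -/
theorem closeZeroOrdinates_anti (L : ℂ → ℂ) {α α' : ℝ} (hαα' : α ≤ α') (T : ℝ) :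
    closeZeroOrdinates L α' T ⊆ closeZeroOrdinates L α T := by
  rintro γ ⟨h2, hT, h⟩
  exact ⟨h2, hT, h.mono (gapRadius_anti (by linarith) hαα')⟩

/-- The divided difference of a point with itself is the derivative (printed convention).
[cite: ConreyIwaniec2002, §10 (10.1)] -/
@[simp] theorem dividedDifference_self (L : ℂ → ℂ) (s : ℂ) :
    dividedDifference L s s = deriv L s := by
  simp [dividedDifference]

/-- For distinct points the divided difference is the difference quotient.
[cite: ConreyIwaniec2002, §10 (10.1)] -/
theorem dividedDifference_of_ne (L : ℂ → ℂ) {s s' : ℂ} (h : s' ≠ s) :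
    dividedDifference L s s' = (L s - L s') / (s - s') := by
  simp [dividedDifference, h]

/-- **(10.1)**: two distinct zeros of `L` are on the same level curve — their divided difference
vanishes. [cite: ConreyIwaniec2002, §10 (10.1)] -/
theorem dividedDifference_eq_zero_of_zeros (L : ℂ → ℂ) {s s' : ℂ} (h : s' ≠ s) (hs : L s = 0)
    (hs' : L s' = 0) : dividedDifference L s s' = 0 := by
  simp [dividedDifference_of_ne L h, hs, hs']

/-- A point set lies in `[2, T]`. [cite: ConreyIwaniec2002, Proposition 10.1] -/
theorem IsPointSet.two_le {S : Finset ℝ} {T : ℝ} (h : IsPointSet S T) {t : ℝ} (ht : t ∈ S) :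
    2 ≤ t :=
  (h.1 t ht).1

/-- A point set lies in `[2, T]`. [cite: ConreyIwaniec2002, Proposition 10.1] -/
theorem IsPointSet.le {S : Finset ℝ} {T : ℝ} (h : IsPointSet S T) {t : ℝ} (ht : t ∈ S) : t ≤ T :=
  (h.1 t ht).2

/-- Point sets are monotone in the height `T`. [cite: ConreyIwaniec2002, Proposition 10.1] -/
theorem IsPointSet.mono {S : Finset ℝ} {T T' : ℝ} (hTT' : T ≤ T') (h : IsPointSet S T) :
    IsPointSet S T' :=
  ⟨fun t ht => ⟨(h.1 t ht).1, (h.1 t ht).2.trans hTT'⟩, h.2⟩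

/-- Subsets of point sets are point sets. [cite: ConreyIwaniec2002, Proposition 10.1] -/
theorem IsPointSet.subset {S S' : Finset ℝ} {T : ℝ} (hSS' : S' ⊆ S) (h : IsPointSet S T) :
    IsPointSet S' T :=
  ⟨fun t ht => h.1 t (hSS' ht), fun t ht u hu => h.2 t (hSS' ht) u (hSS' hu)⟩

/-- The empty set is a point set. [cite: ConreyIwaniec2002, Proposition 10.1] -/
@[simp] theorem isPointSet_empty (T : ℝ) : IsPointSet ∅ T := by
  simp [IsPointSet]

end ConreyIwaniec2002

open ConreyIwaniec2002 NumberField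

/-! ### The named facts -/

/-- **Conrey–Iwaniec 2002, Theorem 1.1.** "Let `A ≥ 0` and `log T ≥ (log q)^{A+6}`. Suppose
`D(α,T) ≥ c T log T / (α (log q)^A)` (1.20) for some `0 < α ≤ 1`, where `c` is a large absolute
constant. Then `L(1,χ) ≥ (log T)^{−2} (log q)^{−2A−6}` (1.21)." Here `K = ℚ(√−q)` with `−q` a
fundamental discriminant, `q > 4`, `χ = (−q/·)`, `ψ ∈ Ĉℓ(K)` any class group character and
`D(α,T)` counts the critical zeros `ρ = ½ + iγ`, `2 ≤ γ ≤ T`, of `L(s,ψ)` whose nearest critical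
zero is within `π(1−α)/log γ` (1.19) ("no Riemann hypothesis is required"; zeros off the line are
allowed and not counted). Rendered: ONE absolute `c > 0` serving all `A ≥ 0`, all such `q, χ, K, ψ`,
all `T ≥ 2` and `0 < α ≤ 1`. (The printed proof, via Proposition 10.1, runs under §7's "`q` odd";
the §1 statement carries no parity restriction and is vendored as stated.) NAMED FACT, not proved
here. [cite: ConreyIwaniec2002, Theorem 1.1] -/
def conreyIwaniec2002_theorem11 : Prop :=
  ∃ c : ℝ, 0 < c ∧
    ∀ A : ℝ, 0 ≤ A →
      ∀ (q : ℕ) [NeZero q], 4 < q → ∀ χ : DirichletCharacter ℂ q,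
        χ.IsPrimitive → χ.IsQuadratic → χ.Odd →
          ∀ (K : Type) [Field K] [NumberField K],
            Module.finrank ℚ K = 2 → NumberField.discr K = -(q : ℤ) →
              ∀ (ψ : ClassGroup (𝓞 K) →* ℂˣ) (T α : ℝ), 2 ≤ T → 0 < α → α ≤ 1 →
                Real.log q ^ (A + 6) ≤ Real.log T →
                  c * T * Real.log T / (α * Real.log q ^ A) ≤
                      (closeZeroCount (classGroupLFunction K ψ) α T : ℝ) →
                    Real.log T ^ (-(2 : ℝ)) * Real.log q ^ (-(2 * A + 6)) ≤ ‖χ.LFunction 1‖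

/-- **Conrey–Iwaniec 2002, Corollary 1.3.** "Suppose there are points `2 ≤ t₁ < … < t_R ≤ T` with
`t_{r+1} − t_r ≥ 1` such that `|L′(½ + it_r, ψ)| ≤ (log q)^{7/2}` for `r = 1,…,R`, where
`R ≫ T = exp((log q)^6)`. Then `L(1,χ) ≫ (log q)^{−18}`" (same `K, q, χ, ψ` as Theorem 1.1; "follows
immediately from Proposition 10.1"). Rendered with `T₀ := exp((log q)^6)`, the points as a
`1`-separated finite set in `[2, T₀]` (so `R ≤ T₀ − 1`: "`R ≫ T₀`" is a proportion), and "`≫`" in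
the hypothesis under the convention Conrey–Iwaniec spell out at Corollary 10.2 (implied constant of
the conclusion computable in terms of that of the hypothesis): `∀ c₁ > 0, ∃ c′ > 0`. DERIVATION GAP
RECORDED, NOT REPAIRED: the printed one-line deduction from Proposition 10.1 (`A = 0`, `α = 1`,
`s′_r = s_r`; proved below as `corollary13With_of_proposition101With`, constant coupled to (10.12))
covers only `c₁ ≥ c`, the absolute constant of (10.12) (for `c₁ ≥ 1` the hypothesis is void and the
statement harmless); for smaller proportions the corollary is vendored AS PRINTED. NAMED FACT, not
proved here (vendored as a printed CLAIM whose printed proof covers part of its range).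
[cite: ConreyIwaniec2002, Corollary 1.3] -/
def conreyIwaniec2002_corollary13 : Prop :=
  ∀ c₁ : ℝ, 0 < c₁ → ∃ c' : ℝ, 0 < c' ∧
    ∀ (q : ℕ) [NeZero q], 4 < q → ∀ χ : DirichletCharacter ℂ q,
      χ.IsPrimitive → χ.IsQuadratic → χ.Odd →
        ∀ (K : Type) [Field K] [NumberField K],
          Module.finrank ℚ K = 2 → NumberField.discr K = -(q : ℤ) →
            ∀ (ψ : ClassGroup (𝓞 K) →* ℂˣ) (S : Finset ℝ),
              IsPointSet S (Real.exp (Real.log q ^ (6 : ℕ))) →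
                (∀ t ∈ S, ‖deriv (classGroupLFunction K ψ) (1 / 2 + t * I)‖ ≤
                    Real.log q ^ ((7 : ℝ) / 2)) →
                  c₁ * Real.exp (Real.log q ^ (6 : ℕ)) ≤ (S.card : ℝ) →
                    c' * Real.log q ^ (-(18 : ℝ)) ≤ ‖χ.LFunction 1‖

/-- **Conrey–Iwaniec 2002, Proposition 10.1.** "Let `A ≥ 0` and `log T ≥ (log q)^{A+6}`. Suppose
there is a set of points `S(T) = {s_r = ½ + it_r ; 2 ≤ t₁ < … < t_R ≤ T, t_{r+1} − t_r ≥ 1}` and a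
set of companions `S′(T) = {s′_r = ½ + it′_r ; r = 1,…,R}` such that `|t_r − t′_r| ≤ π(1−α)/log t_r`,
with `0 < α ≤ 1` (10.10), `|(L(s_r) − L(s′_r))/(s_r − s′_r)| ≤ (log q)^{7/2}` (10.11). Suppose the
number of points in the set satisfies `R = |S(T)| ≥ cT/(α (log q)^A)` (10.12) where `c` is a large
absolute constant, effectively computable. Then `L(1,χ) ≥ (log T)^{−2} (log q)^{−2A−6}` (10.13)."
Standing data of §7: `K = ℚ(√−q)`, `−q` the discriminant, **`q` odd**, `q > 4`, `ψ ∈ Ĉℓ(K)`,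
`L(s) = L(s,ψ)`; the quotient means `L′(s_r)` when `s′_r = s_r` ((10.1): `dividedDifference`).
Rendered with ONE absolute `c > 0` outermost, the points as a `Finset ℝ` (`IsPointSet`) and the
companions as a function `t′`. NAMED FACT, not proved here (it rests on §§2–9, the principal
estimate (9.12)). [cite: ConreyIwaniec2002, Proposition 10.1] -/
def conreyIwaniec2002_proposition101 : Prop :=
  ∃ c : ℝ, 0 < c ∧
    ∀ A : ℝ, 0 ≤ A →
      ∀ (q : ℕ) [NeZero q], 4 < q → Odd q → ∀ χ : DirichletCharacter ℂ q,
        χ.IsPrimitive → χ.IsQuadratic → χ.Odd →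
          ∀ (K : Type) [Field K] [NumberField K],
            Module.finrank ℚ K = 2 → NumberField.discr K = -(q : ℤ) →
              ∀ (ψ : ClassGroup (𝓞 K) →* ℂˣ) (T α : ℝ) (S : Finset ℝ) (t' : ℝ → ℝ),
                2 ≤ T → 0 < α → α ≤ 1 → Real.log q ^ (A + 6) ≤ Real.log T →
                  IsPointSet S T →
                    (∀ t ∈ S, |t - t' t| ≤ gapRadius α t) →
                      (∀ t ∈ S, ‖dividedDifference (classGroupLFunction K ψ)
                          (1 / 2 + t * I) (1 / 2 + t' t * I)‖ ≤ Real.log q ^ ((7 : ℝ) / 2)) →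
                        c * T / (α * Real.log q ^ A) ≤ (S.card : ℝ) →
                          Real.log T ^ (-(2 : ℝ)) * Real.log q ^ (-(2 * A + 6)) ≤
                            ‖χ.LFunction 1‖

/-- **Conrey–Iwaniec 2002, Corollary 10.2** (the `ψ = 1` case, "`L(s) = ζ_K(s) = ζ(s)L(s,χ)`, so
we can choose the zeros of `L(s)` from those of `ζ(s)`"). "Let `ρ = ½ + iγ` denote the zeros of
`ζ(s)` on the critical line and `ρ′ = ½ + iγ′` denote the nearest zero to `ρ` on the critical line
(`ρ′ = ρ` if it is a multiple zero). Suppose that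
`#{ρ ; 0 < γ ≤ T, |γ − γ′| ≤ (π/log γ)(1 − 1/√log γ)} ≫ T (log T)^{4/5}` (10.14) for any
`T ≥ 2001`. Then we have `L(1,χ) ≫ (log q)^{−90}` (10.15) where the implied constant is effectively
computable in terms of that in (10.14)." Standing data of §7: `χ = (−q/·)`, `−q` fundamental,
**`q` odd**, `q > 4`. The hypothesis is the tree's `SubnormalGapsHypothesis c` (distinct ordinates,
as in the tree's Theorem 1.2); rendered `∀ c > 0, ∃ c′ > 0`. This is the `q`-odd case of Theorem 1.2
as typed in the tree (`conreyIwaniec2002_corollary102_of_theorem12`). NAMED FACT; its printed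
deduction from Proposition 10.1 is the corpus' discharge target.
[cite: ConreyIwaniec2002, Corollary 10.2] -/
def conreyIwaniec2002_corollary102 : Prop :=
  ∀ c : ℝ, 0 < c → ∃ c' : ℝ, 0 < c' ∧
    (SubnormalGapsHypothesis c →
      ∀ (q : ℕ) [NeZero q], 4 < q → Odd q → ∀ χ : DirichletCharacter ℂ q,
        χ.IsPrimitive → χ.IsQuadratic → χ.Odd →
          c' * Real.log q ^ (-(90 : ℝ)) ≤ ‖χ.LFunction 1‖)

/-! ### Bookkeeping (proved) -/

/-- **Corollary 10.2 is the `q`-odd case of Theorem 1.2** (same hypothesis (1.22) = (10.14), same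
conclusion (1.23) = (10.15)). [cite: ConreyIwaniec2002, Corollary 10.2] -/
theorem conreyIwaniec2002_corollary102_of_theorem12 (h : conreyIwaniec2002_theorem12) :
    conreyIwaniec2002_corollary102 := by
  intro c hc
  obtain ⟨c', hc', h'⟩ := h c hc
  exact ⟨c', hc', fun hyp q _ hq _ χ hprim hquad hodd => h' hyp q hq χ hprim hquad hodd⟩

/-- **The printed specialisation of Theorem 1.1**: "Taking `A = 12` and `log T = (log q)^{18}` we
get `L(1,χ) ≥ (log q)^{−66}`, provided `D(α,T) ≥ α^{−1} c T (log T)^{1/3}`" — with the SAME absolute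
`c` (indeed `(log q)^{A+6} = (log q)^{18} = log T`, `c T log T/(α (log q)^{12}) = α^{−1} c T (log T)^{1/3}`
and `(log T)^{−2}(log q)^{−30} = (log q)^{−66}`). Modulo Theorem 1.1.
[cite: ConreyIwaniec2002, Theorem 1.1 (p. 2, after (1.21))] -/
theorem lOne_ge_log_pow_neg_66_of_theorem11 (h : conreyIwaniec2002_theorem11) :
    ∃ c : ℝ, 0 < c ∧
      ∀ (q : ℕ) [NeZero q], 4 < q → ∀ χ : DirichletCharacter ℂ q,
        χ.IsPrimitive → χ.IsQuadratic → χ.Odd →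
          ∀ (K : Type) [Field K] [NumberField K],
            Module.finrank ℚ K = 2 → NumberField.discr K = -(q : ℤ) →
              ∀ (ψ : ClassGroup (𝓞 K) →* ℂˣ) (T α : ℝ), 2 ≤ T → 0 < α → α ≤ 1 →
                Real.log T = Real.log q ^ (18 : ℝ) →
                  α⁻¹ * c * T * Real.log T ^ ((1 : ℝ) / 3) ≤
                      (closeZeroCount (classGroupLFunction K ψ) α T : ℝ) →
                    Real.log q ^ (-(66 : ℝ)) ≤ ‖χ.LFunction 1‖ := by
  obtain ⟨c, hc, h⟩ := h
  refine ⟨c, hc, fun q _ hq χ hprim hquad hodd K _ _ h2 hdisc ψ T α hT hα hα1 hlogT hD => ?_⟩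
  have hq1 : (1 : ℝ) < q := by exact_mod_cast (show 1 < q by omega)
  have hlq : 0 < Real.log q := Real.log_pos hq1
  have h12 := h 12 (by norm_num) q hq χ hprim hquad hodd K h2 hdisc ψ T α hT hα hα1
  -- `(log q)^{12+6} = (log q)^{18} = log T`
  have hpow : Real.log q ^ ((12 : ℝ) + 6) = Real.log T := by rw [hlogT]; norm_num
  -- `(log T)^{1/3} = (log q)^6`
  have hthird : Real.log T ^ ((1 : ℝ) / 3) = Real.log q ^ (6 : ℝ) := by
    rw [hlogT, ← Real.rpow_mul hlq.le]; norm_num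
  -- the hypothesis (1.20) with `A = 12` is the printed proviso
  have hhyp : c * T * Real.log T / (α * Real.log q ^ (12 : ℝ)) ≤
      (closeZeroCount (classGroupLFunction K ψ) α T : ℝ) := by
    have hq12 : 0 < Real.log q ^ (12 : ℝ) := Real.rpow_pos_of_pos hlq _
    have key : c * T * Real.log T / (α * Real.log q ^ (12 : ℝ)) =
        α⁻¹ * c * T * Real.log T ^ ((1 : ℝ) / 3) := by
      rw [hthird, hlogT, show (18 : ℝ) = 6 + 12 by norm_num, Real.rpow_add hlq]
      field_simp
    rw [key]; exact hD
  have hconc := h12 hpow.le hhyp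
  -- `(log T)^{-2} (log q)^{-30} = (log q)^{-66}`
  have hval : Real.log T ^ (-(2 : ℝ)) * Real.log q ^ (-(2 * 12 + 6 : ℝ)) =
      Real.log q ^ (-(66 : ℝ)) := by
    rw [hlogT, ← Real.rpow_mul hlq.le, ← Real.rpow_add hlq]; norm_num
  rw [← hval]
  exact hconc


/-! ### Coupled-constant forms (cell RULE V1): Proposition 10.1 at a given constant, and
Corollary 1.3 as it follows from it -/

namespace ConreyIwaniec2002

/-- **Proposition 10.1 at the absolute constant `c`** — the body of
`conreyIwaniec2002_proposition101` with its outermost `∃ c` opened (a parametrised predicate, so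
that consequences can be stated with their constants COUPLED to (10.12) instead of re-quantified).
[cite: ConreyIwaniec2002, Proposition 10.1] -/
def proposition101With (c : ℝ) : Prop :=
  ∀ A : ℝ, 0 ≤ A →
    ∀ (q : ℕ) [NeZero q], 4 < q → Odd q → ∀ χ : DirichletCharacter ℂ q,
      χ.IsPrimitive → χ.IsQuadratic → χ.Odd →
        ∀ (K : Type) [Field K] [NumberField K],
          Module.finrank ℚ K = 2 → NumberField.discr K = -(q : ℤ) →
            ∀ (ψ : ClassGroup (𝓞 K) →* ℂˣ) (T α : ℝ) (S : Finset ℝ) (t' : ℝ → ℝ),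
              2 ≤ T → 0 < α → α ≤ 1 → Real.log q ^ (A + 6) ≤ Real.log T →
                IsPointSet S T →
                  (∀ t ∈ S, |t - t' t| ≤ gapRadius α t) →
                    (∀ t ∈ S, ‖dividedDifference (classGroupLFunction K ψ)
                        (1 / 2 + t * I) (1 / 2 + t' t * I)‖ ≤ Real.log q ^ ((7 : ℝ) / 2)) →
                      c * T / (α * Real.log q ^ A) ≤ (S.card : ℝ) →
                        Real.log T ^ (-(2 : ℝ)) * Real.log q ^ (-(2 * A + 6)) ≤
                          ‖χ.LFunction 1‖

/-- **Corollary 1.3 with its constant coupled to (10.12)**, in the scope where Conrey–Iwaniec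
derive it (§7: `q` odd): if `R ≥ c·T₀` points `2 ≤ t₁ < … < t_R ≤ T₀ = exp((log q)^6)`,
`t_{r+1} − t_r ≥ 1`, have `|L′(½ + it_r, ψ)| ≤ (log q)^{7/2}`, then `L(1,χ) ≥ (log q)^{−18}` — with
the SAME `c` as Proposition 10.1 and implied constant `1` in the conclusion (`(log T₀)^{−2}(log q)^{−6}
= (log q)^{−18}`). [cite: ConreyIwaniec2002, Corollary 1.3] -/
def corollary13With (c : ℝ) : Prop :=
  ∀ (q : ℕ) [NeZero q], 4 < q → Odd q → ∀ χ : DirichletCharacter ℂ q,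
    χ.IsPrimitive → χ.IsQuadratic → χ.Odd →
      ∀ (K : Type) [Field K] [NumberField K],
        Module.finrank ℚ K = 2 → NumberField.discr K = -(q : ℤ) →
          ∀ (ψ : ClassGroup (𝓞 K) →* ℂˣ) (S : Finset ℝ),
            IsPointSet S (Real.exp (Real.log q ^ (6 : ℕ))) →
              (∀ t ∈ S, ‖deriv (classGroupLFunction K ψ) (1 / 2 + t * I)‖ ≤
                  Real.log q ^ ((7 : ℝ) / 2)) →
                c * Real.exp (Real.log q ^ (6 : ℕ)) ≤ (S.card : ℝ) →
                  Real.log q ^ (-(18 : ℝ)) ≤ ‖χ.LFunction 1‖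

end ConreyIwaniec2002

/-- `conreyIwaniec2002_proposition101` is `∃ c > 0, proposition101With c` (definitionally).
[cite: ConreyIwaniec2002, Proposition 10.1] -/
theorem conreyIwaniec2002_proposition101_iff :
    conreyIwaniec2002_proposition101 ↔ ∃ c : ℝ, 0 < c ∧ proposition101With c :=
  Iff.rfl

/-- **"The following assertion follows immediately from Proposition 10.1"** (§1, before Corollary
1.3): Corollary 1.3 with coupled constant, from Proposition 10.1 at the same constant — companions
`s′_r = s_r` (so (10.10) holds with `α = 1`, radius `0`, and (10.11) is the printed bound on
`|L′(½ + it_r)|`), `A = 0`, `log T₀ = (log q)^{0+6}`, and (10.13) reads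
`L(1,χ) ≥ (log T₀)^{−2}(log q)^{−6} = (log q)^{−18}`. RH-FREE bookkeeping, no number theory beyond
`log q > 1`. [cite: ConreyIwaniec2002, Corollary 1.3] -/
theorem ConreyIwaniec2002.corollary13With_of_proposition101With {c : ℝ}
    (h : proposition101With c) : corollary13With c := by
  intro q _ hq hoddq χ hprim hquad hodd K _ _ h2 hdisc ψ S hS hder hR
  have hq5 : (5 : ℝ) ≤ q := by exact_mod_cast hq
  have hℓ1 : 1 < Real.log q := by
    rw [Real.lt_log_iff_exp_lt (by linarith)]
    exact Real.exp_one_lt_d9.trans_le (by linarith)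
  have hℓ0 : 0 < Real.log q := by linarith
  set T : ℝ := Real.exp (Real.log q ^ (6 : ℕ)) with hTdef
  have hlogT : Real.log T = Real.log q ^ (6 : ℕ) := Real.log_exp _
  have h6 : 1 < Real.log q ^ (6 : ℕ) := one_lt_pow₀ hℓ1 (by norm_num)
  have hT2 : (2 : ℝ) ≤ T := by
    have h1 := Real.add_one_le_exp (Real.log q ^ (6 : ℕ))
    linarith
  have hlogTq : Real.log q ^ ((0 : ℝ) + 6) ≤ Real.log T := by
    rw [hlogT, show ((0 : ℝ) + 6) = ((6 : ℕ) : ℝ) by norm_num, Real.rpow_natCast]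
  have h10 : ∀ t ∈ S, |t - (fun u : ℝ => u) t| ≤ gapRadius 1 t := by
    intro t _
    simp [gapRadius]
  have h11 : ∀ t ∈ S, ‖dividedDifference (classGroupLFunction K ψ) (1 / 2 + t * I)
      (1 / 2 + (fun u : ℝ => u) t * I)‖ ≤ Real.log q ^ ((7 : ℝ) / 2) := by
    intro t ht
    rw [show (fun u : ℝ => u) t = t from rfl, dividedDifference_self]
    exact hder t ht
  have h12 : c * T / (1 * Real.log q ^ (0 : ℝ)) ≤ (S.card : ℝ) := by
    rw [Real.rpow_zero, one_mul, div_one]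
    exact hR
  have hres := h 0 le_rfl q hq hoddq χ hprim hquad hodd K h2 hdisc ψ T 1 S (fun u : ℝ => u)
    hT2 one_pos le_rfl hlogTq hS h10 h11 h12
  have hval : Real.log T ^ (-(2 : ℝ)) * Real.log q ^ (-(2 * 0 + 6) : ℝ) =
      Real.log q ^ (-(18 : ℝ)) := by
    rw [hlogT, ← Real.rpow_natCast (Real.log q) 6, ← Real.rpow_mul hℓ0.le, ← Real.rpow_add hℓ0]
    norm_num
  rw [← hval]
  exact hres

/-- Corollary 1.3 (coupled constant, `q` odd) modulo Proposition 10.1: there is an absolute `c > 0`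
with `corollary13With c`. [cite: ConreyIwaniec2002, Corollary 1.3] -/
theorem ConreyIwaniec2002.exists_corollary13With_of_proposition101
    (h : conreyIwaniec2002_proposition101) : ∃ c : ℝ, 0 < c ∧ corollary13With c := by
  obtain ⟨c, hc, h⟩ := h
  exact ⟨c, hc, corollary13With_of_proposition101With h⟩

end Literature.NumberTheory.LFunctions

end
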